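import Summits.BirchSwinnertonDyer.BirchSwinnertonDyer.Theorems.ResidualThetaTransportAtTwoResidualSignedLambdaLowerCMAtTwoPairingSumOmegaDivisibility
import Literature.NumberTheory.EllipticCurves.Sprung2012.ColemanMapLambdaActionProofs
import Mathlib.RingTheory.Polynomial.Cyclotomic.Eval
import HarnessLib

/-!
# The PLUS Coleman functional is ONTO at every prime `p` (in particular `p = 2`): `Im P_{2m, c_{2m}} = ω⁻_{2m}·Λ_{2m}`
# as soon as ONE functional takes a `p`-adic unit value at the bottom point `c_0` — Kobayashi Prop. 8.23 at any `p`,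
# in Sprung's functional vocabulary, for a trace-compatible family `Tr_{n+2/n+1} c_{n+2} = −c_n`

Route `ResidualThetaTransportAtTwo` (RTT), crux RSL_g `ResidualSignedLambdaLowerCMAtTwo` (stmt-BirchSwinnertonDyer-22608; node N1 «local⁺ at 2»
of `Cruxes/ResidualThetaCountLowerPureAtTwo/RSLG-LINE-DAG-g14.md`; `CSCAN-SIGNED-AT-TWO-g14.md` §3bis (ii)–(iv)). Seat `prover-bsd-wall-rtt-p2` g14
(`--supports`, closes nothing). Sequel of `…PairingSumOmegaDivisibility` (p654585: `ω⁻_{2m} ∣ P_{2m,c_{2m}}(z)`).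
HONEST FRAMING: THEOREMS ONLY (no definition, no named fact, no instance, no `sorry`); pure algebra of Sprung's `pairingSum` for an ABSTRACT
family of local points `c` with `g^{pⁿ} • c n = c n`, `∑_{s<p} g^{p^{n+1}s} • c (n+2) = −c n` (the `a_p = 0` trace relations through the powers of a
local Galois element `g`) inside a `g⁻¹`-stable subgroup `A`; nothing about any Selmer group or `L`-function; valid for EVERY prime; BSD is not
proved by any of this.

## What (Kobayashi, Invent. Math. 152 (2003), §8.5–8.6 at any `p`; at `p = 2` = the CSCAN blueprint)
* §1 `sum_pow_smul_eq_zsmul` — the orbit norm of the even points: `∑_{j<p^{2m}} gʲ • c (2m) = (−p)^m • c 0` (from the two relations; each genuine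
  step contributes `−1`, each idle step a factor `p`).
* §2 `constantCoeff_pairingSum_even` — `P_{2m,c_{2m}}(z)(0) = (−p)^m · z(c_0)`; `eval_zero_map_cyclotomicOmegaMinus_two_mul` — `ω⁻_{2m}(0) = p^m`;
  **`constantCoeff_quotient_eq`**: if `P_{2m,c_{2m}}(z) = ω⁻_{2m} · u` then `u(0) = (−1)^m z(c_0)`, so **`u` is a unit of `Λ` iff `z(c_0)` is a
  `p`-adic unit** (`isUnit_quotient_iff`) — Kobayashi's «Col⁺_0 = z ↦ z(c_0)» read at level `2m` (no `p ≠ 2` anywhere; the same bookkeeping on the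
  odd family gives the extra factor that is `p − 1`·`2` at odd `p` and `4` at `p = 2`, not treated here).
* §3 `exists_pairingSum_twist` — the `Λ`-action: `P(z ∘ g⁻¹) = (1+T)·P(z) − z(g⁻¹x)·ω_n` (Sprung Def. 3.1 linearity, as the tree's
  `Sprung2012.pairingSum_twist` but for an abstract `g⁻¹`-stable `A`), its iterate `exists_pairingSum_pow_twist`, and polynomial multipliers
  `exists_pairingSum_polynomial_mul`; **`exists_pairingSum_eq_omegaMinus_mul`** — ONTO: if some `z₀` has `p ∤ z₀(c_0)` then for EVERY `a ∈ Λ`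
  there is `z` with `ω_{2m} ∣ P_{2m,c_{2m}}(z) − ω⁻_{2m}·a`, i.e. `Col⁺_{2m}` is surjective onto `Λ_{2m}/(Xω⁺_{2m}) ≅ ω⁻_{2m}Λ_{2m}`.
At `p = 2` on the cyclotomic `ℤ₂`-tower the hypothesis is supplied by HONDA⁺@2's (GEN₀) `d_0 ∉ 2E(ℚ₂)` + `2`-saturation of the bottom layer +
Pontryagin separation (`Literature.Algebra.Module.exists_addMonoidHom_padicInt_not_dvd`), exactly as in `Sprung2012/ColemanMapSurjectiveProofs.lean`
steps 1–2 for odd `p`; that instantiation is left to the 22608 line (it needs the K3/K4 dictionary between `localTraceOfEmb` and powers of `g`).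

References: [Kobayashi2003] Prop. 8.18–8.23, Lemma 8.9, 8.15 (pp. 16–22); [Sprung2012] Def. 3.1 (p. 1489), Prop. 7.3 (p. 1500);
[Washington1997] §7.1–7.2 (Weierstrass division by `ω_n`).
-/

set_option autoImplicit false
-- the Theorems namespace of this sub repeats the summit name by design (D-0017 nested layout)
set_option linter.dupNamespace false

noncomputable section

open scoped Classical
open Polynomial Finset

namespace Summit.BirchSwinnertonDyer.BirchSwinnertonDyer.Theorems.SignedColemanImage

open Literature.NumberTheory.EllipticCurves

universe u

variable {K : Type u} [Field K] {p : ℕ} [Fact p.Prime]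
variable {E : Type u} [Field E] [Algebra K E] (W : WeierstrassCurve K)

/-! ## §1 The orbit norm of the even points: `∑_{j<p^{2m}} gʲ c_{2m} = (−p)^m c_0` -/

section Norm

omit [Fact p.Prime] in
/-- `g^{pⁿ·s}` fixes a point fixed by `g^{pⁿ}`. [folklore] -/
theorem pow_mul_smul_eq_of_pow_smul_eq (g : Field.absoluteGaloisGroup E) {n : ℕ} {y : localPoints W E}
    (hy : g ^ p ^ n • y = y) (s : ℕ) : g ^ (p ^ n * s) • y = y := by
  induction s with
  | zero => simp
  | succ s ih => rw [Nat.mul_succ, pow_add, mul_smul, hy, ih]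

omit [Fact p.Prime] in
/-- One idle step: `∑_{j<p^{n+1}} gʲ y = p • ∑_{j<pⁿ} gʲ y` for `y` fixed by `g^{pⁿ}`. [cite: Kobayashi2003, Lemma 8.9 (p. 16)] -/
theorem sum_pow_smul_succ_of_fixed (g : Field.absoluteGaloisGroup E) {n : ℕ} {y : localPoints W E}
    (hy : g ^ p ^ n • y = y) :
    ∑ j ∈ range (p ^ (n + 1)), g ^ j • y = (p : ℤ) • ∑ j ∈ range (p ^ n), g ^ j • y := by
  rw [show p ^ (n + 1) = p * p ^ n by ring, sum_range_mul_eq_sum_sum p (p ^ n) (fun j ↦ g ^ j • y)]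
  have : ∀ s ∈ range p, ∑ t ∈ range (p ^ n), g ^ (t + p ^ n * s) • y = ∑ t ∈ range (p ^ n), g ^ t • y :=
    fun s _ ↦ sum_congr rfl fun t _ ↦ by rw [pow_add, mul_smul, pow_mul_smul_eq_of_pow_smul_eq W g hy s]
  rw [sum_congr rfl this, sum_const, card_range, ← natCast_zsmul]

omit [Fact p.Prime] in
/-- One genuine step: `∑_{j<p^{n+2}} gʲ c_{n+2} = −∑_{j<p^{n+1}} gʲ c_n` from the trace relation
`∑_{s<p} g^{p^{n+1}s} c_{n+2} = −c_n`. [cite: Kobayashi2003, Lemma 8.9 (p. 16)] -/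
theorem sum_pow_smul_add_two_of_trace (g : Field.absoluteGaloisGroup E) (c : ℕ → localPoints W E) (n : ℕ)
    (htr : ∑ s ∈ range p, g ^ (p ^ (n + 1) * s) • c (n + 2) = -c n) :
    ∑ j ∈ range (p ^ (n + 2)), g ^ j • c (n + 2) = -∑ j ∈ range (p ^ (n + 1)), g ^ j • c n := by
  rw [show p ^ (n + 2) = p * p ^ (n + 1) by ring, sum_range_mul_eq_sum_sum p (p ^ (n + 1)) (fun j ↦ g ^ j • c (n + 2)),
    sum_comm, ← sum_neg_distrib]
  refine sum_congr rfl fun r _ ↦ ?_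
  rw [← smul_neg, ← htr, smul_sum]
  exact sum_congr rfl fun s _ ↦ by rw [pow_add, mul_smul]

omit [Fact p.Prime] in
/-- **The orbit norm of the even points**: `∑_{j<p^{2m}} gʲ • c_{2m} = (−p)^m • c_0`.
[cite: Kobayashi2003, Lemma 8.9 and proof of Prop. 8.23 (pp. 16, 22)] -/
theorem sum_pow_smul_eq_zsmul (g : Field.absoluteGaloisGroup E) (c : ℕ → localPoints W E)
    (hfix : ∀ n, g ^ p ^ n • c n = c n) (htr : ∀ n, ∑ s ∈ range p, g ^ (p ^ (n + 1) * s) • c (n + 2) = -c n) (m : ℕ) :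
    ∑ j ∈ range (p ^ (2 * m)), g ^ j • c (2 * m) = ((-(p : ℤ)) ^ m) • c 0 := by
  induction m with
  | zero => simp
  | succ m ih =>
    rw [show 2 * (m + 1) = 2 * m + 2 by ring, sum_pow_smul_add_two_of_trace W g c (2 * m) (htr (2 * m)),
      sum_pow_smul_succ_of_fixed W g (hfix (2 * m)), ih, smul_smul, ← neg_smul, pow_succ]
    congr 1
    ring

end Norm

/-! ## §2 Constant terms: `P_{2m}(z)(0) = (−p)^m z(c_0)`, `ω⁻_{2m}(0) = p^m`, and the unit criterion -/

section Const

/-- `P_{n,x}(z)(0) = ∑_{j<pⁿ} z(gʲ x)` (evaluation at the trivial character). [cite: Sprung2012, Def. 3.1 (p. 1489)] -/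
theorem constantCoeff_pairingSum (A : AddSubgroup (localPoints W E)) (g : Field.absoluteGaloisGroup E) (n : ℕ)
    (x : localPoints W E) (z : A →+ ℤ_[p]) :
    PowerSeries.constantCoeff (Sprung2012.pairingSum W A g n x z) =
      ∑ j ∈ range (p ^ n), Sprung2012.evalOn W A z (g ^ j • x) := by
  rw [Sprung2012.pairingSum_def, map_sum]
  refine sum_congr rfl fun j _ ↦ ?_
  rw [map_mul, map_pow, PowerSeries.constantCoeff_C, map_add, map_one, PowerSeries.constantCoeff_X, add_zero, one_pow, mul_one]

/-- **`P_{2m, c_{2m}}(z)(0) = (−p)^m · z(c_0)`**. [cite: Kobayashi2003, proof of Prop. 8.23 (p. 22)] -/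
theorem constantCoeff_pairingSum_even (A : AddSubgroup (localPoints W E)) (g : Field.absoluteGaloisGroup E)
    (c : ℕ → localPoints W E) (hA : ∀ n j, g ^ j • c n ∈ A) (hfix : ∀ n, g ^ p ^ n • c n = c n)
    (htr : ∀ n, ∑ s ∈ range p, g ^ (p ^ (n + 1) * s) • c (n + 2) = -c n) (z : A →+ ℤ_[p]) (m : ℕ) :
    PowerSeries.constantCoeff (Sprung2012.pairingSum W A g (2 * m) (c (2 * m)) z) =
      ((-(p : ℤ)) ^ m : ℤ) * z ⟨c 0, by simpa using hA 0 0⟩ := by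
  rw [constantCoeff_pairingSum]
  have hmem : ∀ j, g ^ j • c (2 * m) ∈ A := fun j ↦ hA _ _
  calc ∑ j ∈ range (p ^ (2 * m)), Sprung2012.evalOn W A z (g ^ j • c (2 * m))
      = ∑ j ∈ range (p ^ (2 * m)), z ⟨g ^ j • c (2 * m), hmem j⟩ :=
        sum_congr rfl fun j _ ↦ Sprung2012.evalOn_of_mem W A z (hmem j)
    _ = z (∑ j ∈ range (p ^ (2 * m)), ⟨g ^ j • c (2 * m), hmem j⟩) := (map_sum z _ _).symm
    _ = z (((-(p : ℤ)) ^ m) • ⟨c 0, by simpa using hA 0 0⟩) := by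
        congr 1
        apply Subtype.ext
        push_cast
        exact sum_pow_smul_eq_zsmul W g c hfix htr m
    _ = ((-(p : ℤ)) ^ m : ℤ) * z ⟨c 0, by simpa using hA 0 0⟩ := by rw [map_zsmul, zsmul_eq_mul]

/-- **`ω⁻_{2m}(0) = p^m`**: each factor `Φ_{p^{2k−1}}(X+1)` contributes `Φ_{p^{2k−1}}(1) = p`. [cite: Washington1997, §7.2] -/
theorem eval_zero_map_cyclotomicOmegaMinus_two_mul {R : Type*} [CommRing R] (m : ℕ) :
    ((cyclotomicOmegaMinus p (2 * m)).map (Int.castRingHom R)).eval 0 = (p : R) ^ m := by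
  have hp : p.Prime := Fact.out
  induction m with
  | zero => simp
  | succ m ih =>
    rw [show 2 * (m + 1) = 2 * m + 2 by ring, cyclotomicOmegaMinus_two_mul_add_two, Polynomial.map_mul, eval_mul, ih,
      Polynomial.map_comp, map_cyclotomic, eval_comp]
    have h1 : ((X + 1 : ℤ[X]).map (Int.castRingHom R)).eval 0 = 1 := by simp
    rw [h1, eval_one_cyclotomic_prime_pow, pow_succ]

/-- The constant coefficient of `ω⁻_{2m}` read in `Λ = ℤ_p⟦T⟧`. [cite: Washington1997, §7.2] -/
theorem constantCoeff_coe_map_cyclotomicOmegaMinus_two_mul (m : ℕ) :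
    PowerSeries.constantCoeff ((((cyclotomicOmegaMinus p (2 * m)).map (Int.castRingHom ℤ_[p]) : ℤ_[p][X]) :
      PowerSeries ℤ_[p])) = (p : ℤ_[p]) ^ m := by
  rw [← PowerSeries.coeff_zero_eq_constantCoeff_apply, Polynomial.coeff_coe, coeff_zero_eq_eval_zero,
    eval_zero_map_cyclotomicOmegaMinus_two_mul]

/-- **The quotient's constant term**: if `P_{2m,c_{2m}}(z) = ω⁻_{2m} · u` in `Λ` then `u(0) = (−1)^m · z(c_0)`.
[cite: Kobayashi2003, proof of Prop. 8.23 (p. 22)] -/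
theorem constantCoeff_quotient_eq (A : AddSubgroup (localPoints W E)) (g : Field.absoluteGaloisGroup E)
    (c : ℕ → localPoints W E) (hA : ∀ n j, g ^ j • c n ∈ A) (hfix : ∀ n, g ^ p ^ n • c n = c n)
    (htr : ∀ n, ∑ s ∈ range p, g ^ (p ^ (n + 1) * s) • c (n + 2) = -c n) (z : A →+ ℤ_[p]) (m : ℕ)
    (u : PowerSeries ℤ_[p])
    (hu : Sprung2012.pairingSum W A g (2 * m) (c (2 * m)) z =
      (((cyclotomicOmegaMinus p (2 * m)).map (Int.castRingHom ℤ_[p]) : ℤ_[p][X]) : PowerSeries ℤ_[p]) * u) :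
    PowerSeries.constantCoeff u = ((-1 : ℤ) ^ m : ℤ) * z ⟨c 0, by simpa using hA 0 0⟩ := by
  have h := congr_arg PowerSeries.constantCoeff hu
  rw [constantCoeff_pairingSum_even W A g c hA hfix htr z m, map_mul, constantCoeff_coe_map_cyclotomicOmegaMinus_two_mul] at h
  push_cast at h ⊢
  rw [neg_pow] at h
  have hp0 : ((p : ℤ_[p]) ^ m) ≠ 0 := pow_ne_zero _ (Nat.cast_ne_zero.mpr (Fact.out : p.Prime).ne_zero)
  refine mul_left_cancel₀ hp0 ?_
  rw [← h]
  ring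

/-- **Unit criterion**: with `P_{2m,c_{2m}}(z) = ω⁻_{2m}·u`, `u ∈ Λˣ` iff `z(c_0) ∈ ℤ_pˣ`.
[cite: Kobayashi2003, Prop. 8.23 (p. 22)] -/
theorem isUnit_quotient_iff (A : AddSubgroup (localPoints W E)) (g : Field.absoluteGaloisGroup E)
    (c : ℕ → localPoints W E) (hA : ∀ n j, g ^ j • c n ∈ A) (hfix : ∀ n, g ^ p ^ n • c n = c n)
    (htr : ∀ n, ∑ s ∈ range p, g ^ (p ^ (n + 1) * s) • c (n + 2) = -c n) (z : A →+ ℤ_[p]) (m : ℕ)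
    (u : PowerSeries ℤ_[p])
    (hu : Sprung2012.pairingSum W A g (2 * m) (c (2 * m)) z =
      (((cyclotomicOmegaMinus p (2 * m)).map (Int.castRingHom ℤ_[p]) : ℤ_[p][X]) : PowerSeries ℤ_[p]) * u) :
    IsUnit u ↔ IsUnit (z ⟨c 0, by simpa using hA 0 0⟩) := by
  rw [PowerSeries.isUnit_iff_constantCoeff, constantCoeff_quotient_eq W A g c hA hfix htr z m u hu, IsUnit.mul_iff]
  have h1 : IsUnit (((-1 : ℤ) ^ m : ℤ) : ℤ_[p]) := by
    rw [Int.cast_pow, Int.cast_neg, Int.cast_one]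
    exact (isUnit_one.neg).pow m
  exact ⟨fun h ↦ h.2, fun h ↦ ⟨h1, h⟩⟩

end Const

/-! ## §3 The `Λ`-action on functionals and the surjectivity -/

section Onto

open Literature.NumberTheory.EllipticCurves.Sprung2017

/-- **The twist** (`Λ`-linearity of `P_{n,x}`, Sprung Def. 3.1): for `A` stable under `g⁻¹`, `x` fixed by `g^{pⁿ}` with orbit in `A` and a
functional `z` on `A`, the functional `z' = z ∘ g⁻¹` has `P_{n,x}(z') = (1+T)·P_{n,x}(z) − z(g⁻¹x)·ω_n`.
[cite: Sprung2012, Def. 3.1 (p. 1489) and §2 p. 1486 (γ ↦ 1 + X)] -/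
theorem exists_pairingSum_twist (A : AddSubgroup (localPoints W E)) (g : Field.absoluteGaloisGroup E)
    (hAinv : ∀ a ∈ A, g⁻¹ • a ∈ A) (n : ℕ) (x : localPoints W E) (hx : g ^ p ^ n • x = x) (hxA : ∀ j, g ^ j • x ∈ A)
    (z : A →+ ℤ_[p]) :
    ∃ (z' : A →+ ℤ_[p]) (b : ℤ_[p]), Sprung2012.pairingSum W A g n x z' =
        (1 + PowerSeries.X) * Sprung2012.pairingSum W A g n x z - PowerSeries.C b * toIwasawa p (cyclotomicOmega p n) := by
  let z' : A →+ ℤ_[p] :=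
    { toFun := fun a ↦ z ⟨g⁻¹ • (a : localPoints W E), hAinv a a.2⟩
      map_zero' := by
        have h0 : (⟨g⁻¹ • ((0 : A) : localPoints W E), hAinv _ (0 : A).2⟩ : A) = 0 := Subtype.ext (by simp)
        simp only [h0, map_zero]
      map_add' := fun a b ↦ by
        rw [← map_add]
        congr 1
        exact Subtype.ext (by simp [smul_add]) }
  have hx0 : x ∈ A := by simpa using hxA 0
  refine ⟨z', z ⟨g⁻¹ • x, hAinv x hx0⟩, ?_⟩
  -- values of `z'` on the orbit: `z'(gʲ⁺¹ x) = z(gʲ x)` and `z'(x) = z(g⁻¹ x)`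
  have hval : ∀ j, Sprung2012.evalOn W A z' (g ^ (j + 1) • x) = Sprung2012.evalOn W A z (g ^ j • x) := by
    intro j
    rw [Sprung2012.evalOn_of_mem W A z' (hxA (j + 1)), Sprung2012.evalOn_of_mem W A z (hxA j)]
    change z ⟨g⁻¹ • (g ^ (j + 1) • x), _⟩ = z ⟨g ^ j • x, _⟩
    congr 1
    apply Subtype.ext
    show g⁻¹ • (g ^ (j + 1) • x) = g ^ j • x
    rw [← mul_smul, pow_succ', ← mul_assoc, inv_mul_cancel, one_mul]
  have hval0 : Sprung2012.evalOn W A z' (g ^ 0 • x) = z ⟨g⁻¹ • x, hAinv x hx0⟩ := by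
    rw [Sprung2012.evalOn_of_mem W A z' (hxA 0)]
    change z ⟨g⁻¹ • (g ^ 0 • x), _⟩ = z ⟨g⁻¹ • x, _⟩
    congr 1
    apply Subtype.ext
    show g⁻¹ • (g ^ 0 • x) = g⁻¹ • x
    rw [pow_zero, one_smul]
  have hvalN : Sprung2012.evalOn W A z' (g ^ p ^ n • x) = z ⟨g⁻¹ • x, hAinv x hx0⟩ := by
    rw [hx, ← hval0, pow_zero, one_smul]
  -- `(1+T)·P(z) = ∑_{j<N} C(z'(gʲ⁺¹x))(1+T)^{j+1} = P(z') + C(z'(x))·((1+T)^N − 1)`, `N = pⁿ`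
  have h1 : (1 + PowerSeries.X) * Sprung2012.pairingSum W A g n x z =
      ∑ j ∈ range (p ^ n), PowerSeries.C (Sprung2012.evalOn W A z' (g ^ (j + 1) • x)) * (1 + PowerSeries.X) ^ (j + 1) := by
    rw [Sprung2012.pairingSum_def, mul_sum]
    refine sum_congr rfl fun j _ ↦ ?_
    rw [hval j, pow_succ]
    ring
  have h2 : ∑ j ∈ range (p ^ n), PowerSeries.C (Sprung2012.evalOn W A z' (g ^ (j + 1) • x)) * (1 + PowerSeries.X) ^ (j + 1) =
      Sprung2012.pairingSum W A g n x z' +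
        PowerSeries.C (z ⟨g⁻¹ • x, hAinv x hx0⟩) * ((1 + PowerSeries.X) ^ p ^ n - 1) := by
    -- `h : ∑_{i<N+1} f i = ∑_{j<N} f (j+1) + f 0`, with `f N = C(z'x)(1+T)^N` and `f 0 = C(z'x)`
    have h := sum_range_succ' (fun i ↦ PowerSeries.C (Sprung2012.evalOn W A z' (g ^ i • x)) * (1 + PowerSeries.X) ^ i) (p ^ n)
    rw [sum_range_succ, hvalN, hval0, pow_zero, mul_one] at h
    rw [Sprung2012.pairingSum_def]
    linear_combination -h
  rw [h1, h2, Sprung2012.toIwasawa_cyclotomicOmega]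
  ring

/-- **Iterated twists**: for every `k` there is a functional `w` with `P_{n,x}(w) ≡ (1+T)^k · P_{n,x}(z) (mod ω_n)`.
[cite: Sprung2012, Def. 3.1 (p. 1489)] -/
theorem exists_pairingSum_pow_twist (A : AddSubgroup (localPoints W E)) (g : Field.absoluteGaloisGroup E)
    (hAinv : ∀ a ∈ A, g⁻¹ • a ∈ A) (n : ℕ) (x : localPoints W E) (hx : g ^ p ^ n • x = x) (hxA : ∀ j, g ^ j • x ∈ A)
    (z : A →+ ℤ_[p]) (k : ℕ) :
    ∃ w : A →+ ℤ_[p], toIwasawa p (cyclotomicOmega p n) ∣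
      Sprung2012.pairingSum W A g n x w - (1 + PowerSeries.X) ^ k * Sprung2012.pairingSum W A g n x z := by
  induction k with
  | zero => exact ⟨z, by simp⟩
  | succ k ih =>
    obtain ⟨w, hw⟩ := ih
    obtain ⟨w', b, hw'⟩ := exists_pairingSum_twist W A g hAinv n x hx hxA w
    refine ⟨w', ?_⟩
    have : Sprung2012.pairingSum W A g n x w' - (1 + PowerSeries.X) ^ (k + 1) * Sprung2012.pairingSum W A g n x z =
        (1 + PowerSeries.X) * (Sprung2012.pairingSum W A g n x w - (1 + PowerSeries.X) ^ k * Sprung2012.pairingSum W A g n x z) +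
          (-PowerSeries.C b) * toIwasawa p (cyclotomicOmega p n) := by
      rw [hw']; ring
    rw [this]
    exact dvd_add (Dvd.dvd.mul_left hw _) (Dvd.intro_left _ rfl)

/-- **Polynomial multipliers in the `(1+T)`-basis**: for every `q ∈ ℤ_p[X]` there is `w` with
`P_{n,x}(w) ≡ q(1+T) · P_{n,x}(z) (mod ω_n)` (`q(1+T) = q.comp (X+1)` read in `Λ`). [cite: Sprung2012, Def. 3.1 (p. 1489)] -/
theorem exists_pairingSum_comp_mul (A : AddSubgroup (localPoints W E)) (g : Field.absoluteGaloisGroup E)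
    (hAinv : ∀ a ∈ A, g⁻¹ • a ∈ A) (n : ℕ) (x : localPoints W E) (hx : g ^ p ^ n • x = x) (hxA : ∀ j, g ^ j • x ∈ A)
    (z : A →+ ℤ_[p]) (q : ℤ_[p][X]) :
    ∃ w : A →+ ℤ_[p], toIwasawa p (cyclotomicOmega p n) ∣
      Sprung2012.pairingSum W A g n x w - ((q.comp (X + 1) : ℤ_[p][X]) : PowerSeries ℤ_[p]) * Sprung2012.pairingSum W A g n x z := by
  induction q using Polynomial.induction_on' with
  | add q₁ q₂ h₁ h₂ =>
    obtain ⟨w₁, hw₁⟩ := h₁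
    obtain ⟨w₂, hw₂⟩ := h₂
    refine ⟨w₁ + w₂, ?_⟩
    rw [Sprung2012.pairingSum_add, add_comp, Polynomial.coe_add]
    convert dvd_add hw₁ hw₂ using 1
    ring
  | monomial k a =>
    obtain ⟨w, hw⟩ := exists_pairingSum_pow_twist W A g hAinv n x hx hxA z k
    refine ⟨a • w, ?_⟩
    rw [Sprung2012.pairingSum_smul, ← C_mul_X_pow_eq_monomial, mul_comp, C_comp, pow_comp, X_comp, Polynomial.coe_mul,
      Polynomial.coe_pow, Polynomial.coe_C, Polynomial.coe_add, Polynomial.coe_X, Polynomial.coe_one, add_comm PowerSeries.X 1]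
    convert Dvd.dvd.mul_left hw (PowerSeries.C a) using 1
    ring

/-- **`Col⁺` is ONTO at every prime**: for `A` stable under `g⁻¹` and a family `c` with `g^{pⁿ} • c n = c n`,
`∑_{s<p} g^{p^{n+1}s} • c (n+2) = −c n`, orbits in `A`, if SOME functional `z₀ : A →+ ℤ_p` takes a unit value at `c_0`, then for every
`a ∈ Λ = ℤ_p⟦T⟧` there is a functional `z` with `ω_{2m} ∣ P_{2m, c_{2m}}(z) − ω⁻_{2m} · a` — i.e. the image of `P_{2m,c_{2m}}` is exactly
`ω⁻_{2m}·Λ_{2m}` (containment is `cyclotomicOmegaMinus_dvd_pairingSum`) and the plus Coleman map at level `2m` is surjective onto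
`Λ_{2m}/(X ω⁺_{2m})`. Kobayashi Prop. 8.23 at any `p`; at `p = 2` this is the decisive local input of RSL_g (no `λ`/`μ`-correction on the plus side).
[cite: Kobayashi2003, Prop. 8.23 (p. 22)] [cite: Sprung2012, Prop. 7.3 (p. 1500)] -/
theorem exists_pairingSum_eq_omegaMinus_mul (A : AddSubgroup (localPoints W E)) (g : Field.absoluteGaloisGroup E)
    (hAinv : ∀ a ∈ A, g⁻¹ • a ∈ A) (c : ℕ → localPoints W E) (hA : ∀ n j, g ^ j • c n ∈ A) (hfix : ∀ n, g ^ p ^ n • c n = c n)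
    (htr : ∀ n, ∑ s ∈ range p, g ^ (p ^ (n + 1) * s) • c (n + 2) = -c n)
    (z₀ : A →+ ℤ_[p]) (hz₀ : IsUnit (z₀ ⟨c 0, by simpa using hA 0 0⟩)) (m : ℕ) (a : PowerSeries ℤ_[p]) :
    ∃ z : A →+ ℤ_[p], toIwasawa p (cyclotomicOmega p (2 * m)) ∣
      Sprung2012.pairingSum W A g (2 * m) (c (2 * m)) z - toIwasawa p (cyclotomicOmegaMinus p (2 * m)) * a := by
  -- `P(z₀) = ω⁻ · u` with `u` a unit
  obtain ⟨u, hu⟩ := cyclotomicOmegaMinus_dvd_pairingSum W A g c hA hfix htr z₀ m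
  have hunit : IsUnit u := (isUnit_quotient_iff W A g c hA hfix htr z₀ m u hu).mpr hz₀
  obtain ⟨v, hv⟩ := hunit.exists_right_inv
  -- Weierstrass: `a·u⁻¹ ≡ r (mod ω)` for a polynomial `r`, written in the `(1+T)`-basis through `q = r.comp (X − 1)`
  obtain ⟨r, hr⟩ := Sprung2012.exists_polynomial_toIwasawa_cyclotomicOmega_dvd_sub (p := p) (2 * m) (a * v)
  obtain ⟨w, hw⟩ := exists_pairingSum_comp_mul W A g hAinv (2 * m) (c (2 * m)) (hfix (2 * m)) (hA (2 * m)) z₀ (r.comp (X - 1))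
  have hcomp : (r.comp (X - 1)).comp (X + 1) = r := by
    rw [comp_assoc, sub_comp, X_comp, one_comp, add_sub_cancel_right, comp_X]
  rw [hcomp, hu] at hw
  refine ⟨w, ?_⟩
  have key : Sprung2012.pairingSum W A g (2 * m) (c (2 * m)) w - toIwasawa p (cyclotomicOmegaMinus p (2 * m)) * a =
      (Sprung2012.pairingSum W A g (2 * m) (c (2 * m)) w -
          (r : PowerSeries ℤ_[p]) * (toIwasawa p (cyclotomicOmegaMinus p (2 * m)) * u)) +
        -(toIwasawa p (cyclotomicOmegaMinus p (2 * m)) * u * (a * v - (r : PowerSeries ℤ_[p]))) := by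
    have : toIwasawa p (cyclotomicOmegaMinus p (2 * m)) * a = toIwasawa p (cyclotomicOmegaMinus p (2 * m)) * u * (a * v) := by
      rw [mul_comm a v, ← mul_assoc, mul_assoc _ u v, hv, mul_one]
    rw [this]; ring
  rw [key]
  exact dvd_add hw (dvd_neg.mpr (Dvd.dvd.mul_left hr _))

end Onto

end Summit.BirchSwinnertonDyer.BirchSwinnertonDyer.Theorems.SignedColemanImage

end
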